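import Summits.QuantumFields.YangMills.Theorems.LuscherReductionTwistedTraceScalingInnerTwoZone
import Summits.QuantumFields.YangMills.Theorems.LuscherReductionTwistedTraceScalingOnionRefined
import Summits.QuantumFields.YangMills.Theorems.LuscherReductionRunningReductionLatticeLargeField
import HarnessLib

/-!
# «ratepack-v2» stub `stub_shellGain` ⟸ lane A's typed C4-SHELL deliverable: the action-free SHELL GAIN from the SMALL-ACTION shell gain at the record action scale `β^{-17/20}`
# (large fields by `e^{-βη}` suppression through the action phase split), and monotonicity in the core radius (`β^{-1/5} ≤ β^{-1/6}`)
# (route `FlatTubeReduction`, crux K1 `NearFlatRatioLaw` stmt-QuantumFields-24720; seat `ym-line-ftr-p1` g10; R2b1 RECORD rung — no summit statement is proved here)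

The third stub of skeleton «ratepack-v2» (`Cruxes/NearFlatRatioLaw/Lines/ratepack_v2.lean`) is `∀ L ≥ 2, InnerShellGainAt L (powScale (1/6)) (powScale (1/40))` (action-free).  Lane A's typed
deliverable (COARSE-DESIGN §22.6 (c)) is the SMALL-ACTION shell `InnerShellGainSmallAt L (powScale (1/5)) (powScale (1/40)) (powScale (17/20))`.  THIS FILE proves the implication:
* `innerShellGainSmallAt_mono_core` — the small-action shell gain is monotone in the core radius (`δc ≤ δc'` pointwise ⇒ from `δc` to `δc'`);
* ★★ `innerShellGainAt_of_small_record` — `InnerShellGainSmallAt L δc δ (powScale (17/20)) → InnerShellGainAt L δc δ`: split a shell function with the ACTION PHASE at `η = β^{-17/20}`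
  (`qform_le_localized_actionPhase₂`, defect `½(π²/4)e^{-βη/2}c_β^{|E|}`); the `cos`-piece has small action (the hypothesis at `A+1`), the `sin`-piece has `S > η` and is
  `e^{-βη}c_β^{|E|}`-suppressed (`qform_le_exp_neg_of_action_ge_lat`); `e^{-β^{3/20}/2} ≪ λ_b(L³β)` closes the margin `e^{-Aλ} − e^{-(A+1)λ} ≥ λ/4`;
* ★★ `stub_shellGain_of_laneA` — `(∀ L ≥ 2, InnerShellGainSmallAt L (powScale (1/5)) (powScale (1/40)) (powScale (17/20))) → ∀ L ≥ 2, InnerShellGainAt L (powScale (1/6)) (powScale (1/40))`.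
HONEST FRAMING: glue; the small-action shell gain is lane A's OPEN C4-SHELL target; femto rung R2b1 (RECORD label); not infinite volume, not a gap, not Clay.  No defs, no named facts, no `sorry`.
-/

set_option autoImplicit false

noncomputable section

open MeasureTheory Filter Topology Real
open scoped BigOperators
open Literature.MathematicalPhysics.QuantumFieldTheory
open Literature.MathematicalPhysics.QuantumLattice

namespace Summit.QuantumFields.YangMills.Theorems.FemtoTransferGap.RateTube

open Summit.QuantumFields.YangMills.Theorems.FemtoTransferGap

variable {L : ℕ} [NeZero L]

/-! ## §1 Monotonicity in the core radius -/

/-- The small-action shell gain is monotone in the core radius: a larger core leaves a smaller shell. [folklore] -/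
theorem innerShellGainSmallAt_mono_core {δc δc' δ η : ℝ → ℝ} (hle : ∃ β1 : ℝ, ∀ β : ℝ, β1 ≤ β → δc β ≤ δc' β)
    (h : InnerShellGainSmallAt L δc δ η) : InnerShellGainSmallAt L δc' δ η := by
  intro A
  obtain ⟨β0, h0⟩ := h A
  obtain ⟨β1, h1⟩ := hle
  refine ⟨max β0 β1, fun β hβ φ hφ hsupp => h0 β ((le_max_left _ _).trans hβ) φ hφ fun U hU => ?_⟩
  obtain ⟨hS, hz, hfar⟩ := hsupp U hU
  exact ⟨hS, hz, fun z => lt_of_le_of_lt (by linarith [h1 β ((le_max_right _ _).trans hβ)]) (hfar z)⟩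

/-! ## §2 Super-exponential smallness of the large-field factors against `λ_b` -/

/-- ★ For every `C ≥ 0`, eventually `C·e^{-β·β^{-17/20}/2} ≤ λ_b(L³β)` (the large-field factor is super-exponentially small; we only use `e^{-x} ≤ 24/x⁴` and cube both sides). [folklore] -/
theorem eventually_largeField_le_bareLambda {C : ℝ} (hC : 0 ≤ C) :
    ∀ᶠ β : ℝ in atTop, C * Real.exp (-(β * powScale (17 / 20) β / 2)) ≤ bareLambda ((L : ℝ) ^ 3 * β) := by
  have ht : Tendsto (fun β : ℝ => β ^ ((4 : ℝ) / 5)) atTop atTop := tendsto_rpow_atTop (by norm_num)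
  filter_upwards [ht.eventually_ge_atTop ((384 * C) ^ 3 * (L : ℝ) ^ 3 / 2 + 1), Filter.eventually_ge_atTop (1 : ℝ)] with β hβ hβ1
  have hβ0 : 0 < β := by linarith
  have hL0 : (0 : ℝ) < (L : ℝ) := by exact_mod_cast Nat.pos_of_ne_zero (NeZero.ne L)
  have hB0 : 0 < (L : ℝ) ^ 3 * β := by positivity
  set lam := bareLambda ((L : ℝ) ^ 3 * β) with hlam
  have hlam0 : 0 < lam := bareLambda_pos' hB0
  -- the large-field exponent: `β·β^{-17/20} = β^{3/20}`
  have hx : β * powScale (17 / 20) β = β ^ ((3 : ℝ) / 20) := by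
    rw [powScale_eq hβ1]
    have e : β * β ^ (-(17 / 20 : ℝ)) = β ^ (1 : ℝ) * β ^ (-(17 / 20 : ℝ)) := by rw [Real.rpow_one]
    rw [e, ← Real.rpow_add hβ0]; norm_num
  have hxpos : 0 < β ^ ((3 : ℝ) / 20) / 2 := by positivity
  have hb35 : 0 < β ^ ((3 : ℝ) / 5) := Real.rpow_pos_of_pos hβ0 _
  -- `e^{-x} ≤ 24/x⁴ = 384 β^{-3/5}`
  have h1 : Real.exp (-(β * powScale (17 / 20) β / 2)) ≤ 384 / β ^ ((3 : ℝ) / 5) := by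
    rw [hx]
    -- `e^{-x} ≤ 24/x⁴` (`x⁴/4! ≤ e^x`; cf. `Literature…MoebiusSum.exp_neg_le_div_pow_four`, not imported to keep the import cone small)
    have hexp4 : Real.exp (-(β ^ ((3 : ℝ) / 20) / 2)) ≤ 24 / (β ^ ((3 : ℝ) / 20) / 2) ^ 4 := by
      have h := Real.pow_div_factorial_le_exp (β ^ ((3 : ℝ) / 20) / 2) hxpos.le 4
      have h4 : ((4 : ℕ).factorial : ℝ) = 24 := by norm_num [Nat.factorial]
      rw [h4] at h
      rw [Real.exp_neg, inv_eq_one_div, div_le_div_iff₀ (Real.exp_pos _) (by positivity)]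
      linarith
    refine hexp4.trans (le_of_eq ?_)
    have e4 : (β ^ ((3 : ℝ) / 20) / 2) ^ 4 = β ^ ((3 : ℝ) / 5) / 16 := by
      rw [div_pow, ← Real.rpow_natCast (β ^ ((3 : ℝ) / 20)) 4, ← Real.rpow_mul hβ0.le]; norm_num
    rw [e4, div_div_eq_mul_div]; norm_num
  -- cube comparison: `(384 C / β^{3/5})³ = (384C)³/β^{9/5} ≤ λ³ = 2/(L³β)` iff `(384C)³ L³ ≤ 2 β^{4/5}`
  have hcube : ((L : ℝ) ^ 3 * β) * lam ^ 3 = 2 := bareLambda_cube hB0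
  have hK : (384 * C) ^ 3 * (L : ℝ) ^ 3 ≤ 2 * β ^ ((4 : ℝ) / 5) := by linarith
  have h2 : (C * (384 / β ^ ((3 : ℝ) / 5))) ^ 3 ≤ lam ^ 3 := by
    have e1 : (C * (384 / β ^ ((3 : ℝ) / 5))) ^ 3 = (384 * C) ^ 3 / β ^ ((9 : ℝ) / 5) := by
      have : (β ^ ((3 : ℝ) / 5)) ^ 3 = β ^ ((9 : ℝ) / 5) := by
        rw [← Real.rpow_natCast (β ^ ((3 : ℝ) / 5)) 3, ← Real.rpow_mul hβ0.le]; norm_num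
      rw [mul_pow, div_pow, this]; ring
    have e2 : lam ^ 3 = 2 / ((L : ℝ) ^ 3 * β) := by rw [eq_div_iff hB0.ne']; linear_combination hcube
    have e95 : β ^ ((9 : ℝ) / 5) = β ^ ((4 : ℝ) / 5) * β := by
      rw [show ((9 : ℝ) / 5) = (4 : ℝ) / 5 + 1 by norm_num, Real.rpow_add_one hβ0.ne']
    have h95 : 0 < β ^ ((9 : ℝ) / 5) := Real.rpow_pos_of_pos hβ0 _
    rw [e1, e2, div_le_div_iff₀ h95 hB0, e95]
    linarith [mul_le_mul_of_nonneg_right hK hβ0.le]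
  have h3 : C * (384 / β ^ ((3 : ℝ) / 5)) ≤ lam :=
    (pow_le_pow_iff_left₀ (by positivity) hlam0.le (by norm_num : (3 : ℕ) ≠ 0)).mp h2
  calc C * Real.exp (-(β * powScale (17 / 20) β / 2)) ≤ C * (384 / β ^ ((3 : ℝ) / 5)) := mul_le_mul_of_nonneg_left h1 hC
    _ ≤ lam := h3

/-! ## §3 ★★ The action-free shell gain from the small-action one -/

set_option maxHeartbeats 400000 in
/-- ★★ **`InnerShellGainSmallAt L δc δ (powScale (17/20)) → InnerShellGainAt L δc δ`.**  Split `φ` with the action phase at `η = β^{-17/20}`: the `cos`-piece has `S < 2η` and the shell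
support of `φ` (small-action shell gain at `A + 1`), the `sin`-piece has `S > η` (`e^{-βη}c_β^{|E|}`), the cut costs `½(π²/4)e^{-βη/2}c_β^{|E|}`; both large-field factors are
`≪ (λ/4)·λ₀` (`eventually_largeField_le_bareLambda`, `levelValue_zero_ge_uniform`), which is the margin `e^{-Aλ} − e^{-(A+1)λ}`. [cite: Luscher1983, §3] [cite: Balaban1989LargeFieldII, p.355] -/
theorem innerShellGainAt_of_small_record {δc δ : ℝ → ℝ} (h : InnerShellGainSmallAt L δc δ (powScale (17 / 20))) : InnerShellGainAt L δc δ := by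
  intro A
  obtain ⟨βS, hS⟩ := h (A + 1)
  have hu := uniformFloorConst_pos (L := L)
  have hL1 : (1 : ℝ) ≤ (L : ℝ) ^ 3 := one_le_pow₀ (by exact_mod_cast NeZero.one_le)
  -- the large-field factors against `λ/16 · uniformFloorConst`
  obtain ⟨βF, hF⟩ := Filter.eventually_atTop.mp
    (eventually_largeField_le_bareLambda (L := L) (C := 16 * (1 + π ^ 2 / 8) / uniformFloorConst L) (by positivity))
  have hτ0 : (0 : ℝ) < 1 / (2 * (|A| + 1)) := by positivity
  refine ⟨max (max βS βF) (max 1 (2 / (1 / (2 * (|A| + 1))) ^ 3)), fun β hβ φ hφ hsupp => ?_⟩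
  have hβS : βS ≤ β := ((le_max_left _ _).trans (le_max_left _ _)).trans hβ
  have hβF : βF ≤ β := ((le_max_right _ _).trans (le_max_left _ _)).trans hβ
  have hβ1 : 1 ≤ β := ((le_max_left _ _).trans (le_max_right _ _)).trans hβ
  have hβτ : 2 / (1 / (2 * (|A| + 1))) ^ 3 ≤ β := ((le_max_right _ _).trans (le_max_right _ _)).trans hβ
  have hβ0 : 0 < β := by linarith
  set lam := bareLambda ((L : ℝ) ^ 3 * β) with hlam
  have hB0 : 0 < (L : ℝ) ^ 3 * β := by positivity
  have hlam0 : 0 < lam := bareLambda_pos' hB0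
  have hlamτ : lam ≤ 1 / (2 * (|A| + 1)) := bareLambda_cube_le (L := L) hτ0 hβτ
  set Λ := levelValue su2Rep L β 0 with hΛ
  have hΛ0 : 0 < Λ := levelValue_su2Rep_pos hβ0 0
  have hfloor : uniformFloorConst L * latCE L β ≤ Λ := levelValue_zero_ge_uniform (L := L) hβ1
  have hCE := (latCE_pos (L := L) hβ0.le).le
  -- the large-field factor (before abbreviating `η`)
  have hLF := hF β hβF
  rw [← hlam] at hLF
  set η : ℝ := powScale (17 / 20) β with hηdef
  have hη0 : 0 < η := powScale_pos _ _
  -- the action split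
  have hsplit := qform_le_localized_actionPhase₂ hβ0 hη0 hφ
  have hcP : IsPhys fun U => Real.cos (actionPhase η U) * φ U := isPhys_valley η hφ
  have hsP : IsPhys fun U => Real.sin (actionPhase η U) * φ U := isPhys_largeField η hφ
  have hnorm := l2_cos_add_l2_sin (measurable_actionPhase η) hφ
  set nc : ℝ := l2 (fun U => Real.cos (actionPhase η U) * φ U) (fun U => Real.cos (actionPhase η U) * φ U) with hnc
  set ns : ℝ := l2 (fun U => Real.sin (actionPhase η U) * φ U) (fun U => Real.sin (actionPhase η U) * φ U) with hns
  set n : ℝ := l2 φ φ with hn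
  have hnc0 : 0 ≤ nc := l2_self_nonneg_lat _
  have hns0 : 0 ≤ ns := l2_self_nonneg_lat _
  have hn0 : 0 ≤ n := l2_self_nonneg_lat _
  have hncs : nc + ns = n := hnorm
  -- cos-piece: small-action shell gain at `A + 1`
  have hcos : qform su2Rep β (fun U => Real.cos (actionPhase η U) * φ U) (fun U => Real.cos (actionPhase η U) * φ U) ≤ Real.exp (-((A + 1) * lam)) * Λ * nc :=
    hS β hβS _ hcP fun U hU => by
      refine ⟨?_, (hsupp U (right_ne_zero_of_mul hU)).1, (hsupp U (right_ne_zero_of_mul hU)).2⟩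
      exact action_lt_of_cos_actionPhase_ne_zero hη0 (left_ne_zero_of_mul hU)
  -- sin-piece: large field, `S > η`
  have hsin : qform su2Rep β (fun U => Real.sin (actionPhase η U) * φ U) (fun U => Real.sin (actionPhase η U) * φ U) ≤ Real.exp (-(β * η)) * latCE L β * ns :=
    qform_le_exp_neg_of_action_ge_lat hβ0.le hsP fun U hU => (action_gt_of_sin_actionPhase_ne_zero hη0 (left_ne_zero_of_mul hU)).le
  -- the two large-field factors are `≤ (λ/16) uniformFloorConst`
  have hE1 : Real.exp (-(β * η)) ≤ Real.exp (-(β * η / 2)) := Real.exp_le_exp.2 (by nlinarith [mul_pos hβ0 hη0])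
  have hsmall : 16 * (1 + π ^ 2 / 8) * Real.exp (-(β * η / 2)) ≤ lam * uniformFloorConst L := by
    have h' : 16 * (1 + π ^ 2 / 8) * Real.exp (-(β * η / 2)) / uniformFloorConst L ≤ lam := by
      rw [← div_mul_eq_mul_div]; exact hLF
    rwa [div_le_iff₀ hu] at h'
  -- margin: `e^{-Aλ} − e^{-(A+1)λ} ≥ (λ/4) e^{-Aλ} ≥ λ/8` (as `e^{-Aλ} ≥ 1/2`)
  have hA2 : (1 : ℝ) / 2 ≤ Real.exp (-(A * lam)) := by
    have h1 : A * lam ≤ 1 / 2 := by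
      have h2 : A * lam ≤ |A| * lam := mul_le_mul_of_nonneg_right (le_abs_self A) hlam0.le
      have h3 : |A| * lam ≤ |A| * (1 / (2 * (|A| + 1))) := mul_le_mul_of_nonneg_left hlamτ (abs_nonneg A)
      have h4 : |A| * (1 / (2 * (|A| + 1))) ≤ 1 / 2 := by
        rw [mul_div_assoc', div_le_iff₀ (by positivity)]; nlinarith [abs_nonneg A]
      linarith
    have h5 : Real.exp (-(1 / 2 : ℝ)) ≤ Real.exp (-(A * lam)) := Real.exp_le_exp.2 (by linarith)
    refine le_trans ?_ h5
    rw [Real.exp_neg, le_inv_comm₀ (by norm_num) (Real.exp_pos _)]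
    have h6 : Real.exp (1 / 2 : ℝ) ≤ 2 := by
      have h7 : Real.exp (1 / 2 : ℝ) ^ 2 = Real.exp 1 := by rw [← Real.exp_nat_mul]; norm_num
      nlinarith [Real.exp_one_lt_d9, Real.exp_pos (1 / 2 : ℝ)]
    simpa using h6
  have hlam1 : lam ≤ 1 := hlamτ.trans (by rw [div_le_one (by positivity)]; nlinarith [abs_nonneg A])
  have hmargin : lam / 8 ≤ Real.exp (-(A * lam)) - Real.exp (-((A + 1) * lam)) := by
    have e1 : Real.exp (-((A + 1) * lam)) = Real.exp (-(A * lam)) * Real.exp (-lam) := by rw [← Real.exp_add]; congr 1; ring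
    rw [e1, ← mul_one_sub]
    have h8 : lam / 2 ≤ 1 - Real.exp (-lam) := by
      have g1 : 1 + lam ≤ Real.exp lam := by have := Real.add_one_le_exp lam; linarith
      have g3 : Real.exp (-lam) * Real.exp lam = 1 := by rw [← Real.exp_add]; simp
      have g4 := Real.exp_pos (-lam)
      have g5 : Real.exp (-lam) * (1 + lam) ≤ 1 := by
        have := mul_le_mul_of_nonneg_left g1 g4.le; linarith
      by_cases hf : 1 / 2 ≤ Real.exp (-lam)
      · have := mul_le_mul_of_nonneg_right hf hlam0.le; linarith
      · linarith
    have := mul_le_mul hA2 h8 (by linarith) (Real.exp_pos _).le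
    linarith
  -- assemble
  have hexpA1 : Real.exp (-((A + 1) * lam)) ≤ Real.exp (-(A * lam)) := Real.exp_le_exp.2 (by nlinarith)
  have h1 : qform su2Rep β φ φ ≤ Real.exp (-((A + 1) * lam)) * Λ * n + (1 + π ^ 2 / 8) * Real.exp (-(β * η / 2)) * latCE L β * n := by
    have hs' : Real.exp (-(β * η)) * latCE L β * ns ≤ Real.exp (-(β * η / 2)) * latCE L β * n := by
      have := mul_le_mul_of_nonneg_right (mul_le_mul_of_nonneg_right hE1 hCE) hns0
      have h2 : Real.exp (-(β * η / 2)) * latCE L β * ns ≤ Real.exp (-(β * η / 2)) * latCE L β * n :=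
        mul_le_mul_of_nonneg_left (by linarith) (by positivity)
      linarith
    have hc' : Real.exp (-((A + 1) * lam)) * Λ * nc ≤ Real.exp (-((A + 1) * lam)) * Λ * n :=
      mul_le_mul_of_nonneg_left (by linarith) (by positivity)
    linarith [hsplit, hcos, hsin, hs', hc']
  have h2 : (1 + π ^ 2 / 8) * Real.exp (-(β * η / 2)) * latCE L β ≤ lam / 16 * Λ := by
    have h3 : (1 + π ^ 2 / 8) * Real.exp (-(β * η / 2)) ≤ lam * uniformFloorConst L / 16 := by linarith [hsmall]
    calc (1 + π ^ 2 / 8) * Real.exp (-(β * η / 2)) * latCE L β ≤ lam * uniformFloorConst L / 16 * latCE L β := mul_le_mul_of_nonneg_right h3 hCE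
      _ = lam / 16 * (uniformFloorConst L * latCE L β) := by ring
      _ ≤ lam / 16 * Λ := mul_le_mul_of_nonneg_left hfloor (by positivity)
  calc qform su2Rep β φ φ ≤ Real.exp (-((A + 1) * lam)) * Λ * n + lam / 16 * Λ * n := by
        have := mul_le_mul_of_nonneg_right h2 hn0; linarith [h1]
    _ ≤ Real.exp (-(A * lam)) * Λ * n := by
        have := mul_le_mul_of_nonneg_right (mul_le_mul_of_nonneg_right hmargin hΛ0.le) hn0
        have h0 : 0 ≤ lam * Λ * n := mul_nonneg (mul_nonneg hlam0.le hΛ0.le) hn0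
        linarith

/-! ## §4 ★★ The stub of «ratepack-v2» from lane A's typed deliverable -/

/-- ★★ **`stub_shellGain` ⟸ lane A's C4-SHELL**: `InnerShellGainSmallAt L (β^{-1/5}) (β^{-1/40}) (β^{-17/20})` for every `L ≥ 2` gives `InnerShellGainAt L (β^{-1/6}) (β^{-1/40})` for every
`L ≥ 2` (core monotonicity `β^{-1/5} ≤ β^{-1/6}`, then `innerShellGainAt_of_small_record`). [cite: Luscher1983, §3] -/
theorem stub_shellGain_of_laneA
    (h : ∀ (L : ℕ) [NeZero L], 2 ≤ L → InnerShellGainSmallAt L (powScale (1 / 5)) (powScale (1 / 40)) (powScale (17 / 20))) :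
    ∀ (L : ℕ) [NeZero L], 2 ≤ L → InnerShellGainAt L (powScale (1 / 6)) (powScale (1 / 40)) := by
  intro L _ hL
  refine innerShellGainAt_of_small_record (innerShellGainSmallAt_mono_core ⟨1, fun β hβ => ?_⟩ (h L hL))
  rw [powScale_eq hβ, powScale_eq hβ]
  exact Real.rpow_le_rpow_of_exponent_le hβ (by norm_num)

end Summit.QuantumFields.YangMills.Theorems.FemtoTransferGap.RateTube

end
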